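import Summits.CriticalPhenomena.PercolationContinuityZ3.Theorems.Transplant.FKConnectivityAllQTwoClusterRayleighGraded
import Summits.CriticalPhenomena.PercolationContinuityZ3.Theorems.Transplant.FKConnectivityAllQForestAdjacentRayleighNd
import HarnessLib

/-!
# The SQUARE-FREE nodes (NOT asserted): coefficientwise opposite-seed negative correlation `CwOsncFibreOn` (Conjecture R without `W²`),
# its q-graded form `TwoClusterRayleighGradedNoSqOn` (R_q without `q⁻²W²`) and the square-free adjacent forest Rayleigh node
# `AdjForestRayleighNoSqOn` — with the kernel arrows `R ⇒ CW-OSNC ⇒ OSNC ⇒ EDOM ⇒ CA₂ ⇒ FP2`, `R_q ⇒ R_q⁰ ⇒ CW-OSNC`, and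
# `AdjForestNoSq ⇒` adjacent-edge negative correlation of the arboreal gas

Support file (`--supports stmt-CriticalPhenomena-4575`), FK sub-lane `prim-bschramm-fk-1` (gen 16) of the post-continuity programme;
builds on p205010 (kernel theorem, internal audit signed; external expert review pending).  Definitions (three counting predicates, three
`@[conjecture]` nodes — NOT asserted), no named facts, no sorries; standard axioms.

WHY (fk-1 g16, kit j142598 + local exact re-verification, memo bschramm/FROM-fk-1-g16-FOREST-SLICE.md §1c): the Cibulka–Hladký–LaCroix–Wagner
SQUARE does NOT survive below tree level in general.  The square-strengthened adjacent forest Rayleigh inequality (♣)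
`N(0,OVY) ≤ N(OV,OY) + N(OY,VY) + N(VY,OV) + N(0,VY)` (node `AdjForestRayleighPos`), true on every graph with ≤ 8 vertices in 1.3·10⁹ exact
placements, has its FIRST FAILURES ON 9 VERTICES (12 placements of 241,920,000 sampled; verified by two exact engines: `H` on `{0..8}` with
`E(H) = {23,67,24,45,36,15,58,07,17,46,08,04,12}` (13 = 2·9 − 5 edges), `(o,v,y) = (4,3,8)`: `N(0,OVY) = 310 > 228 + 28 + 28 + 24`, while
`310 ≤ 312` without the square), and since
`…ForestAdjacentSlice.lean` derives (♣) from `TwoClusterRayleighGradedOn` at a fresh vertex (kernel), Conjecture R_q WITH its square term is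
false on 10 vertices (`G = H +` isolated `c`, `s = 5`: good 528 < bad 526 + sq 4).  The SQUARE-FREE versions have NO failure anywhere (n = 9: 0 / 241,920,000; n ≤ 8: 0 / 1.3·10⁹; R_q without square
(g15 'T0'): 0 / 7.8·10⁷ cells; CW-OSNC (g14/g15): 0 / 1.5·10⁸ fibres).  This file types the square-free statements as the live targets:
* `CwOsncFibreOn V` (CW-OSNC): on every fibre whose common part joins `a ~ u`, `c ~ x` (guard `e, f ∉ ω`):
  `#(ω∪{e,f} ∈ E, ω∆M ∈ E) ≤ #(ω∪{e} ∈ E, (ω∆M)∪{f} ∈ E)`, `E = {a ↮ c} ∩ {k = 2}` — Conjecture R without `W²`;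
  **`cwOsncFibreOn_of_rayleighFibreOn`** (R ⇒ CW-OSNC), **`seedNegCorrOn_of_cwOsncFibreOn`** (CW-OSNC ⇒ OSNC for every weight vector,
  folding fibres of positive weight), hence `twoCluster{SeedNegCorr,EdgeDom,Assoc,FourPoint}Pos_of_cwOsncFibrePos`.
* `TwoClusterRayleighGradedNoSqOn V` (R_q⁰): `bad(s) ≤ good(s)` for every fibre and level (the node of `…RayleighGraded.lean` without the
  `sq(s+2)` term) — coefficientwise-in-`(x,y,q)` FK-OSNC; **`gradedNoSqOn_of_gradedOn`** (R_q ⇒ R_q⁰), **`cwOsncFibreOn_of_gradedNoSqOn`**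
  (the `s = 4` slice of R_q⁰ is CW-OSNC).
* `AdjForestRayleighNoSqOn V`: `#(Fo ∩ J_e ∩ J_f, Fo) ≤ #(Fo ∩ J_e, Fo ∩ J_f)` (`e = ov ≠ f = oy`) — plain coefficientwise forest Rayleigh at
  an adjacent pair, i.e. Semple–Welsh's 'strong independence correlation' restricted to ADJACENT pairs (false for non-adjacent pairs on K₄);
  **`adjForestNoSq_of_adjForest`**, **`ag_adjacent_negCorr_of_adjForestNoSq`** (⇒ `μ(J_e ∩ J_f)·μ(Ω) ≤ μ(J_e)·μ(J_f)` for the arboreal gas).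
[cite: CibulkaHladkyLaCroixWagner2008, Thm. 1 (p. 2)] [cite: SempleWelsh2008, Conj. 1.1 (p. 2); Thm. 4.2 (p. 11)]
[cite: Grimmett2006, §1.5 eq. (1.22) (p. 13); §3.9 eq. (3.94) (p. 63)] [cite: VandenbergHaggstromKahn2005, Thm. 1.4 (p. 7)] [cite: Linusson2011, Prop. 2.6]
-/

noncomputable section

namespace Summit.CriticalPhenomena.PercolationContinuityZ3.Theorems

namespace FK

open MeasureTheory Set Literature.Probability.LatticeModels Literature.Probability.Percolation
open Literature.Probability.Percolation.BHK2006 (weight weight_nonneg)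
open scoped Classical symmDiff

variable {V : Type*} [Fintype V]

/-! ### CW-OSNC: Conjecture R without the square -/

/-- **Coefficientwise opposite-seed negative correlation on the vertex type `V`** (CW-OSNC): for every fibre whose common part joins
`a ~ u`, `c ~ x`, `#(ω∪{e,f} ∈ E, ω∆M ∈ E) ≤ #(ω∪{e} ∈ E, (ω∆M)∪{f} ∈ E)`, `E = {a↮c} ∩ {k=2}`, guard `e, f ∉ ω`.
[cite: Grimmett2006, §3.9 eq. (3.94) (p. 63)] [cite: Linusson2011, Prop. 2.6] -/
def CwOsncFibreOn (V : Type*) [Fintype V] : Prop :=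
  ∀ (M u₀ : BondConfig V), Disjoint u₀ M → ∀ (a c u v x y : V),
    (openGraph u₀).Reachable a u → (openGraph u₀).Reachable c x →
    fibreCount M u₀ ({ω | s(u, v) ∉ ω ∧ s(x, y) ∉ ω} ∩ {ω | insert s(x, y) (insert s(u, v) ω) ∈ twoClusterEv a c})
        ({ω | s(u, v) ∉ ω ∧ s(x, y) ∉ ω} ∩ twoClusterEv a c) ≤
      fibreCount M u₀ ({ω | s(u, v) ∉ ω ∧ s(x, y) ∉ ω} ∩ {ω | insert s(u, v) ω ∈ twoClusterEv a c})
        ({ω | s(u, v) ∉ ω ∧ s(x, y) ∉ ω} ∩ {ω | insert s(x, y) ω ∈ twoClusterEv a c})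

/-- **CW-OSNC on every finite vertex type.**  CONJECTURE-SHAPED COUNTING STATEMENT, NOT asserted; 0 deficits in every census (fk-1 g14/g15:
1.5·10⁸ fibres, n ≤ 8); the square-strengthened form (Conjecture R) inherits the n = 9 doubt recorded in the file header.
[cite: Grimmett2006, §3.9 eq. (3.94) (p. 63)] -/
@[conjecture] def CwOsncFibrePos : Prop := ∀ n : ℕ, CwOsncFibreOn (Fin n)

/-- **Conjecture R ⇒ CW-OSNC** (drop the square). [cite: CibulkaHladkyLaCroixWagner2008, Thm. 1 (p. 2)] -/
theorem cwOsncFibreOn_of_rayleighFibreOn (h : TwoClusterRayleighFibreOn V) : CwOsncFibreOn V :=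
  fun M u₀ hd a c u v x y hau hcx => le_trans (Nat.le_add_right _ _) (h M u₀ hd a c u v x y hau hcx)

/-- **CW-OSNC ⇒ OSNC for every weight vector** (folding fibres of positive weight; the flips and the guard as in `…RayleighSquare.lean`).
[cite: Linusson2011, Prop. 2.6] [cite: Grimmett2006, §3.9 eq. (3.94) (p. 63)] -/
theorem seedNegCorrOn_of_cwOsncFibreOn (h : CwOsncFibreOn V) : TwoClusterSeedNegCorrOn V := by
  intro w a c u v x y hau hcx
  have h00e : ((Function.update (Function.update w s(u, v) 0) s(x, y) 0 s(u, v) : unitInterval) : ℝ) = 0 := by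
    by_cases hef : s(u, v) = s(x, y)
    · rw [hef, pin_apply_snd]; simp
    · rw [pin_apply_fst w hef]; simp
  have h00f : ((Function.update (Function.update w s(u, v) 0) s(x, y) 0 s(x, y) : unitInterval) : ℝ) = 0 := by
    rw [pin_apply_snd]; simp
  by_cases hef : s(u, v) = s(x, y)
  · have h10 : Function.update (Function.update w s(u, v) 1) s(x, y) 0 = Function.update (Function.update w s(u, v) 0) s(x, y) 0 := by
      rw [hef, Function.update_idem, Function.update_idem]
    have h01 : Function.update (Function.update w s(u, v) 0) s(x, y) 1 = Function.update (Function.update w s(u, v) 1) s(x, y) 1 := by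
      rw [hef, Function.update_idem, Function.update_idem]
    rw [h10, h01]
    exact le_of_eq (mul_comm _ _)
  have hZ11 : (prodBernoulli (Function.update (Function.update w s(u, v) 1) s(x, y) 1)).real (twoClusterEv a c) =
      (prodBernoulli (Function.update (Function.update w s(u, v) 0) s(x, y) 0)).real
        ({ω | s(u, v) ∉ ω ∧ s(x, y) ∉ ω} ∩ {ω | insert s(x, y) (insert s(u, v) ω) ∈ twoClusterEv a c}) := by
    rw [real_guard_eq h00e h00f, real_update_one_eq_real_update_zero_insert, Function.update_comm hef 1 0 w,
      real_update_one_eq_real_update_zero_insert, Function.update_comm (Ne.symm hef) 0 0 w]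
    rfl
  have hZ10 : (prodBernoulli (Function.update (Function.update w s(u, v) 1) s(x, y) 0)).real (twoClusterEv a c) =
      (prodBernoulli (Function.update (Function.update w s(u, v) 0) s(x, y) 0)).real
        ({ω | s(u, v) ∉ ω ∧ s(x, y) ∉ ω} ∩ {ω | insert s(u, v) ω ∈ twoClusterEv a c}) := by
    rw [real_guard_eq h00e h00f, Function.update_comm hef 1 0 w, real_update_one_eq_real_update_zero_insert,
      Function.update_comm (Ne.symm hef) 0 0 w]
  have hZ01 : (prodBernoulli (Function.update (Function.update w s(u, v) 0) s(x, y) 1)).real (twoClusterEv a c) =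
      (prodBernoulli (Function.update (Function.update w s(u, v) 0) s(x, y) 0)).real
        ({ω | s(u, v) ∉ ω ∧ s(x, y) ∉ ω} ∩ {ω | insert s(x, y) ω ∈ twoClusterEv a c}) := by
    rw [real_guard_eq h00e h00f, real_update_one_eq_real_update_zero_insert]
  have hZ00 : (prodBernoulli (Function.update (Function.update w s(u, v) 0) s(x, y) 0)).real (twoClusterEv a c) =
      (prodBernoulli (Function.update (Function.update w s(u, v) 0) s(x, y) 0)).real
        ({ω | s(u, v) ∉ ω ∧ s(x, y) ∉ ω} ∩ twoClusterEv a c) := (real_guard_eq h00e h00f _).symm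
  rw [hZ11, hZ10, hZ01, hZ00]
  have key := real_mul_add_mul_le_of_fibrewise_pos (Function.update (Function.update w s(u, v) 0) s(x, y) 0)
    ({ω | s(u, v) ∉ ω ∧ s(x, y) ∉ ω} ∩ {ω | insert s(x, y) (insert s(u, v) ω) ∈ twoClusterEv a c})
    ({ω | s(u, v) ∉ ω ∧ s(x, y) ∉ ω} ∩ twoClusterEv a c) ∅ ∅
    ({ω | s(u, v) ∉ ω ∧ s(x, y) ∉ ω} ∩ {ω | insert s(u, v) ω ∈ twoClusterEv a c})
    ({ω | s(u, v) ∉ ω ∧ s(x, y) ∉ ω} ∩ {ω | insert s(x, y) ω ∈ twoClusterEv a c}) fun M u₀ hd hpos => ?_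
  · rw [measureReal_empty, mul_zero, add_zero] at key
    exact key
  have hu₀ : 0 < weight (fun g => ((Function.update (Function.update w s(u, v) 0) s(x, y) 0 g : unitInterval) : ℝ)) u₀ := by
    rcases eq_or_lt_of_le (weight_nonneg (fun g => (Function.update (Function.update w s(u, v) 0) s(x, y) 0 g).2.1)
      (fun g => (Function.update (Function.update w s(u, v) 0) s(x, y) 0 g).2.2) u₀) with h0 | h0
    · rw [← h0, zero_mul] at hpos; exact absurd hpos (lt_irrefl 0)
    · exact h0
  have hsure := sureGraph_le_openGraph_of_weight_pos hu₀
  rw [fibreCount_eq_zero_of_left M u₀ rfl, add_zero]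
  exact h M u₀ hd a c u v x y (hau.mono hsure) (hcx.mono hsure)

/-- **`CwOsncFibrePos → TwoClusterSeedNegCorrPos`.** [cite: Grimmett2006, §3.9 eq. (3.94) (p. 63)] -/
theorem twoClusterSeedNegCorrPos_of_cwOsncFibrePos (h : CwOsncFibrePos) : TwoClusterSeedNegCorrPos :=
  fun n => seedNegCorrOn_of_cwOsncFibreOn (h n)

/-- **`CwOsncFibrePos → TwoClusterEdgeDomPos`.** [cite: Grimmett2006, §3.9 (pp. 63–65)] -/
theorem twoClusterEdgeDomPos_of_cwOsncFibrePos (h : CwOsncFibrePos) : TwoClusterEdgeDomPos :=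
  twoClusterEdgeDomPos_of_seedNegCorrPos (twoClusterSeedNegCorrPos_of_cwOsncFibrePos h)

/-- **`CwOsncFibrePos → TwoClusterAssocPos`.** [cite: VandenbergHaggstromKahn2005, Thm. 1.5 (p. 7)] -/
theorem twoClusterAssocPos_of_cwOsncFibrePos (h : CwOsncFibrePos) : TwoClusterAssocPos :=
  twoClusterAssocPos_of_seedNegCorrPos (twoClusterSeedNegCorrPos_of_cwOsncFibrePos h)

/-- **`CwOsncFibrePos → TwoClusterFourPointPos`.** [cite: KozmaNitzan2024, Thm. 1, eq. (6) (pp. 7–8)] -/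
theorem twoClusterFourPointPos_of_cwOsncFibrePos (h : CwOsncFibrePos) : TwoClusterFourPointPos :=
  twoClusterFourPointPos_of_seedNegCorrPos (twoClusterSeedNegCorrPos_of_cwOsncFibrePos h)

/-! ### R_q⁰: the q-graded node without the square -/

/-- **The square-free q-graded two-cluster Rayleigh node on the vertex type `V`** (R_q⁰): for every fibre whose common part joins `a ~ u`,
`c ~ x`, and every `s`, `Σ_{i+j=s} #(ω∪{e,f} ∈ D∩L_i, ω∆M ∈ D∩L_j) ≤ Σ_{i+j=s} #(ω∪{e} ∈ D∩L_i, (ω∆M)∪{f} ∈ D∩L_j)`, `D = {a ↮ c}` —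
FK-OSNC coefficientwise in `(x, y, q)`. [cite: Grimmett2006, §1.4 eq. (1.20) (p. 15); §3.9 eq. (3.94) (p. 63)] [cite: Linusson2011, Prop. 2.6] -/
def TwoClusterRayleighGradedNoSqOn (V : Type*) [Fintype V] : Prop :=
  ∀ (M u₀ : BondConfig V), Disjoint u₀ M → ∀ (a c u v x y : V) (s : ℕ),
    (openGraph u₀).Reachable a u → (openGraph u₀).Reachable c x →
    gradedCount M u₀ (fun i => {ω | s(u, v) ∉ ω ∧ s(x, y) ∉ ω} ∩ {ω | insert s(x, y) (insert s(u, v) ω) ∈ sepEv a c ∩ levelSet V i})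
        (fun j => {ω | s(u, v) ∉ ω ∧ s(x, y) ∉ ω} ∩ (sepEv a c ∩ levelSet V j)) s ≤
      gradedCount M u₀ (fun i => {ω | s(u, v) ∉ ω ∧ s(x, y) ∉ ω} ∩ {ω | insert s(u, v) ω ∈ sepEv a c ∩ levelSet V i})
        (fun j => {ω | s(u, v) ∉ ω ∧ s(x, y) ∉ ω} ∩ {ω | insert s(x, y) ω ∈ sepEv a c ∩ levelSet V j}) s

/-- **R_q⁰ on every finite vertex type.**  CONJECTURE-SHAPED COUNTING STATEMENT, NOT asserted; 0 negative (fibre, s)-cells in 7.8·10⁷ exact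
cells on graphs with ≤ 8 vertices (fk-1 g15 'T0'); its `s = 4` slice is CW-OSNC (`cwOsncFibreOn_of_gradedNoSqOn`).
[cite: Grimmett2006, §1.4 eq. (1.20) (p. 15); §3.9 eq. (3.94) (p. 63)] -/
@[conjecture] def TwoClusterRayleighGradedNoSqPos : Prop := ∀ n : ℕ, TwoClusterRayleighGradedNoSqOn (Fin n)

/-- **R_q ⇒ R_q⁰** (drop the square term). [cite: CibulkaHladkyLaCroixWagner2008, Thm. 1 (p. 2)] -/
theorem gradedNoSqOn_of_gradedOn (h : TwoClusterRayleighGradedOn V) : TwoClusterRayleighGradedNoSqOn V :=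
  fun M u₀ hd a c u v x y s hau hcx => le_trans (Nat.le_add_right _ _) (h M u₀ hd a c u v x y s hau hcx)

/-- **The `s = 4` slice of R_q⁰ is CW-OSNC.** [cite: Grimmett2006, §1.4 eq. (1.20) (p. 15); §3.9 eq. (3.94) (p. 63)] -/
theorem cwOsncFibreOn_of_gradedNoSqOn (h : TwoClusterRayleighGradedNoSqOn V) : CwOsncFibreOn V := by
  intro M u₀ hd a c u v x y hau hcx
  have key := h M u₀ hd a c u v x y 4 hau hcx
  set Gd : Set (BondConfig V) := {ω | s(u, v) ∉ ω ∧ s(x, y) ∉ ω} with hGd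
  by_cases hV : 2 ≤ Fintype.card V
  · rw [show (4 : ℕ) = 2 * 2 from rfl,
      gradedCount_eq_fibreCount_of_vanishing M u₀ _ _ hV
        (fun i hi => guard_inter_preimage_empty Gd _ (sepEv_inter_levelSet_eq_empty a c hi))
        (fun j hj => by rw [sepEv_inter_levelSet_eq_empty a c hj, inter_empty]),
      gradedCount_eq_fibreCount_of_vanishing M u₀ _ _ hV
        (fun i hi => guard_inter_preimage_empty Gd _ (sepEv_inter_levelSet_eq_empty a c hi))
        (fun j hj => guard_inter_preimage_empty Gd _ (sepEv_inter_levelSet_eq_empty a c hj))] at key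
    exact key
  · -- at most one vertex: `{a ↮ c} = ∅`
    have h1 : Fintype.card V ≤ 1 := by omega
    have hac : a = c := Fintype.card_le_one_iff.1 h1 a c
    have hsep : sepEv a c = (∅ : Set (BondConfig V)) := by
      ext ω; simp only [mem_sepEv_iff, hac, SimpleGraph.Reachable.refl, not_true_eq_false, mem_empty_iff_false]
    have h2 : twoClusterEv a c = (∅ : Set (BondConfig V)) := by rw [twoClusterEv, hsep, empty_inter]
    rw [guard_inter_preimage_empty _ _ h2, fibreCount_eq_zero_of_left M u₀ rfl]
    exact Nat.zero_le _

/-- **`TwoClusterRayleighGradedNoSqPos → CwOsncFibrePos`.** [cite: Grimmett2006, §3.9 eq. (3.94) (p. 63)] -/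
theorem cwOsncFibrePos_of_gradedNoSqPos (h : TwoClusterRayleighGradedNoSqPos) : CwOsncFibrePos :=
  fun n => cwOsncFibreOn_of_gradedNoSqOn (h n)

/-- **`TwoClusterRayleighGradedNoSqPos → TwoClusterSeedNegCorrPos`** (hence EDOM, CA₂, FP2). [cite: Grimmett2006, §3.9 (pp. 63–65)] -/
theorem twoClusterSeedNegCorrPos_of_gradedNoSqPos (h : TwoClusterRayleighGradedNoSqPos) : TwoClusterSeedNegCorrPos :=
  twoClusterSeedNegCorrPos_of_cwOsncFibrePos (cwOsncFibrePos_of_gradedNoSqPos h)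

/-! ### The square-free adjacent forest Rayleigh node -/

/-- **Plain coefficientwise forest Rayleigh at an adjacent pair on the vertex type `V`** (`e = ov ≠ f = oy`): for every fibre,
`#(Fo ∩ J_e ∩ J_f, Fo) ≤ #(Fo ∩ J_e, Fo ∩ J_f)`. [cite: SempleWelsh2008, Conj. 1.1 (p. 2); Thm. 4.2 (p. 11)] [cite: Linusson2011, Prop. 2.6] -/
def AdjForestRayleighNoSqOn (V : Type*) [Fintype V] : Prop :=
  ∀ (M u₀ : BondConfig V), Disjoint u₀ M → ∀ (o v y : V), v ≠ y →
    fibreCount M u₀ (forestEv V ∩ {ω | s(o, v) ∈ ω ∧ s(o, y) ∈ ω}) (forestEv V) ≤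
      fibreCount M u₀ (forestEv V ∩ {ω | s(o, v) ∈ ω}) (forestEv V ∩ {ω | s(o, y) ∈ ω})

/-- **Plain coefficientwise forest Rayleigh at adjacent pairs, every finite vertex type** — 'strong independence correlation' (Semple–Welsh)
restricted to ADJACENT pairs.  CONJECTURE-SHAPED, NOT asserted; 0 failures in 1.3·10⁹ exact placements on graphs with ≤ 8 vertices and in
241,920,000 sampled placements on 9 vertices (where the square-strengthened form fails 12 times); false for non-adjacent pairs (K₄).
[cite: SempleWelsh2008, Conj. 1.1 (p. 2); Thm. 4.2 (p. 11)] -/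
@[conjecture] def AdjForestRayleighNoSqPos : Prop := ∀ n : ℕ, AdjForestRayleighNoSqOn (Fin n)

/-- The square-strengthened node implies the square-free one. [cite: CibulkaHladkyLaCroixWagner2008, Thm. 1 (p. 2)] -/
theorem adjForestNoSq_of_adjForest (h : AdjForestRayleighOn V) : AdjForestRayleighNoSqOn V :=
  fun M u₀ hd o v y hvy => le_trans (Nat.le_add_right _ _) (h M u₀ hd o v y hvy)

/-- **Node ⇒ adjacent edges are negatively correlated under the arboreal gas**: `μ(J_e ∩ J_f)·μ(Ω) ≤ μ(J_e)·μ(J_f)`, `μ = agMeasure w`,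
`e = ov ≠ f = oy`, every `w`. [cite: Grimmett2006, §1.5 eq. (1.22), Thm. (1.23) (pp. 13–14); §3.9 (pp. 63–65)] [cite: SempleWelsh2008, Conj. 1.1 (p. 2)] -/
theorem ag_adjacent_negCorr_of_adjForestNoSq (h : AdjForestRayleighNoSqOn V) (w : Sym2 V → unitInterval) {o v y : V} (hvy : v ≠ y) :
    (agMeasure w).real {ω | s(o, v) ∈ ω ∧ s(o, y) ∈ ω} * (agMeasure w).real univ ≤
      (agMeasure w).real {ω | s(o, v) ∈ ω} * (agMeasure w).real {ω | s(o, y) ∈ ω} := by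
  by_cases hZ : agPartition w = 0
  · have h0 : ∀ A : Set (BondConfig V), (agMeasure w).real A = 0 := by
      intro A
      rw [agMeasure_real_eq_sum]
      refine Finset.sum_eq_zero fun ω _ => ?_
      unfold agMass; rw [hZ, div_zero, zero_mul]
    simp only [h0, mul_zero, le_refl]
  · have hZpos : 0 < agPartition w := lt_of_le_of_ne (agPartition_nonneg w) (Ne.symm hZ)
    rw [← mul_le_mul_iff_of_pos_right (mul_pos hZpos hZpos)]
    have key : (prodBernoulli w).real (forestEv V ∩ {ω | s(o, v) ∈ ω ∧ s(o, y) ∈ ω}) * (prodBernoulli w).real (forestEv V) ≤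
        (prodBernoulli w).real (forestEv V ∩ {ω | s(o, v) ∈ ω}) * (prodBernoulli w).real (forestEv V ∩ {ω | s(o, y) ∈ ω}) :=
      prodBernoulli_real_mul_le_of_fibrewise w _ _ _ _ fun M u₀ hd => h M u₀ hd o v y hvy
    have e1 := agMeasure_real_mul_agPartition w {ω | s(o, v) ∈ ω ∧ s(o, y) ∈ ω}
    have e2 := agMeasure_real_mul_agPartition w (univ : Set (BondConfig V))
    have e5 := agMeasure_real_mul_agPartition w {ω | s(o, v) ∈ ω}
    have e6 := agMeasure_real_mul_agPartition w {ω | s(o, y) ∈ ω}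
    rw [univ_inter] at e2
    calc (agMeasure w).real {ω | s(o, v) ∈ ω ∧ s(o, y) ∈ ω} * (agMeasure w).real univ * (agPartition w * agPartition w)
        = ((agMeasure w).real {ω | s(o, v) ∈ ω ∧ s(o, y) ∈ ω} * agPartition w) * ((agMeasure w).real univ * agPartition w) := by ring
      _ = (prodBernoulli w).real (forestEv V ∩ {ω | s(o, v) ∈ ω ∧ s(o, y) ∈ ω}) * (prodBernoulli w).real (forestEv V) := by
          rw [e1, e2, inter_comm]
      _ ≤ (prodBernoulli w).real (forestEv V ∩ {ω | s(o, v) ∈ ω}) * (prodBernoulli w).real (forestEv V ∩ {ω | s(o, y) ∈ ω}) := key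
      _ = ((agMeasure w).real {ω | s(o, v) ∈ ω} * agPartition w) * ((agMeasure w).real {ω | s(o, y) ∈ ω} * agPartition w) := by
          rw [e5, e6, inter_comm, inter_comm {ω | s(o, y) ∈ ω}]
      _ = (agMeasure w).real {ω | s(o, v) ∈ ω} * (agMeasure w).real {ω | s(o, y) ∈ ω} * (agPartition w * agPartition w) := by ring

end FK

end Summit.CriticalPhenomena.PercolationContinuityZ3.Theorems

end
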